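import Mathlib
import HarnessLib
import Summits.ResolutionOfSingularities.ResolutionOfSingularities.Theses.HomologicalConductor
import Summits.ResolutionOfSingularities.ResolutionOfSingularities.Theorems.SyzygyFlatteningDefs

/-!
# Route `HomologicalConductor`, crux `NoZeno` (stmt-ResolutionOfSingularities-16483), line `birth` — definitions

The canonical normalised `ca`-tower of route `ResolutionOfSingularities/HomologicalConductor` as
NAMED vocabulary, so that the registered stubs of the line `birth`
(`Cruxes/NoZeno/Lines/birth.lean`) and their helper lemmas can be stated BY NAME in `Theorems/`
files. Every body below is copied VERBATIM from the route file
(`Theses/HomologicalConductor.lean`: the `let`-bound `ca`, `loc`, `chart`, `nrm`, `tower`, textually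
identical in all seven items of the route), so that the crux `NoZeno` restates over these names by
re-abstraction alone (`noZeno_iff` below) and the line's composition stays definitional unfolding.

* `ca B ⊆ K` — the image in `K` of the Iyengar–Takahashi cohomology annihilator of `↥B`
  (`x ∈ B` killing `Extⁱ_B(M, N)` for all `i ≥ n`, all finitely generated `M`, `N`); equal to
  `(↑) '' cohomologyAnnihilator ↥B` by `Subalgebra.image_coe_cohomologyAnnihilator`
  (`Literature/RingTheory/CohomologyAnnihilator/Basic.lean`).
* `loc O B` — `B` localised at the centre of the valuation ring `O`, inside `K`. The body is
  character for character the `let loc` of route `SyzygyFlattening` as well, named there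
  `SyzygyFlattening.locAt` (`Theorems/SyzygyFlatteningDefs.lean`); `loc_eq_locAt` records the
  identity by `rfl`, so the `locAt` library (`…HigherRankTerminationLocAt.lean`: bridge to
  `Literature…locAtCentre`, membership, locality, regularity criterion) applies verbatim.
* `chart O B` — the `O`-chart of the blow-up of `B` along `ca B`: adjoin `c * x⁻¹` for `c ∈ ca B`
  and every nonzero `x ∈ ca B` of minimal value.
* `nrm B` — the normalisation of `B` inside `K`; again character for character
  `SyzygyFlattening.nrm` (`nrm_eq_nrm : … = …` by `rfl`).
* `tower O A m` — `T₀ = loc O A`, `T_(m+1) = loc O (nrm (chart O (T_m)))` (the route's `Nat.rec`).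

No theorem of this file concludes the crux; `loc_eq_locAt`, `nrm_eq_nrm`, `tower_zero`,
`tower_succ` are `rfl` and `noZeno_iff` is re-abstraction of one and the same term.
-/

noncomputable section

-- single-problem summit: the doubled namespace component `ResolutionOfSingularities` is forced
set_option linter.dupNamespace false

namespace Summit.ResolutionOfSingularities.ResolutionOfSingularities.Theorems.NoZeno.Birth

open Summit.ResolutionOfSingularities.ResolutionOfSingularities.Theses.HomologicalConductor

variable {k K : Type} [Field k] [Field K] [Algebra k K]

/-- `ca B ⊆ K` — the image in `K` of the Iyengar–Takahashi **cohomology annihilator** of the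
subalgebra `B`: the `x ∈ B` such that, for some `n`, `x · Extⁱ_B(M, N) = 0` for all `i ≥ n` and
all finitely generated `B`-modules `M`, `N`. Verbatim the route's `let ca`.
[cite: IyengarTakahashi2014, Definition 2.1] -/
def ca (B : Subalgebra k K) : Set K :=
  {x : K | ∃ hx : x ∈ B, ∃ n : ℕ, ∀ i : ℕ, n ≤ i → ∀ (M N : ModuleCat.{0} ↥B),
    Module.Finite ↥B M → Module.Finite ↥B N →
      ∀ e : CategoryTheory.Abelian.Ext.{0} M N i, (⟨x, hx⟩ : ↥B) • e = 0}

/-- `loc O B` — `B` localised at the centre of the valuation ring `O`: the `k`-algebra generated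
by the fractions `a * s⁻¹`, `a, s ∈ B`, `s⁻¹ ∈ O`. Verbatim the route's `let loc` (and the
`let loc` of route `SyzygyFlattening`, see `loc_eq_locAt`). [folklore] -/
def loc (O : ValuationSubring K) (B : Subalgebra k K) : Subalgebra k K :=
  Algebra.adjoin k {y : K | ∃ a ∈ B, ∃ s ∈ B, s⁻¹ ∈ O ∧ y = a * s⁻¹}

/-- `chart O B` — the `O`-chart of the blow-up of `B` along `ca B`: adjoin `c * x⁻¹` for
`c ∈ ca B` and every nonzero `x ∈ ca B` of MINIMAL value (`ca B * x⁻¹ ⊆ O`). Verbatim the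
route's `let chart`. [folklore] -/
def chart (O : ValuationSubring K) (B : Subalgebra k K) : Subalgebra k K :=
  Algebra.adjoin k ((B : Set K) ∪ {y : K | ∃ c ∈ ca B, ∃ x ∈ ca B, x ≠ 0 ∧
    (∀ c' ∈ ca B, c' * x⁻¹ ∈ O) ∧ y = c * x⁻¹})

/-- `nrm B` — the normalisation of `B` inside `K`: the `k`-algebra generated by the elements of
`K` integral over `B`. Verbatim the route's `let nrm` (and `SyzygyFlattening.nrm`, see
`nrm_eq_nrm`). [folklore] -/
def nrm (B : Subalgebra k K) : Subalgebra k K :=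
  Algebra.adjoin k {y : K | IsIntegral ↥B y}

/-- `tower O A m = T_m` — the canonical normalised `ca`-tower along `O`: `T₀ = loc O A`,
`T_(m+1) = loc O (nrm (chart O T_m))`. Verbatim the route's `let tower` (same `Nat.rec`).
[folklore] -/
def tower (O : ValuationSubring K) (A : Subalgebra k K) (m : ℕ) : Subalgebra k K :=
  @Nat.rec (fun _ => Subalgebra k K) (loc O A) (fun _ B => loc O (nrm (chart O B))) m

/-! ## Bridges (`rfl`) -/

/-- `loc` IS `SyzygyFlattening.locAt` (identical bodies). [folklore] -/
theorem loc_eq_locAt (O : ValuationSubring K) (B : Subalgebra k K) :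
    loc O B = SyzygyFlattening.locAt O B :=
  rfl

/-- `nrm` IS `SyzygyFlattening.nrm` (identical bodies). [folklore] -/
theorem nrm_eq_nrm (B : Subalgebra k K) : nrm B = SyzygyFlattening.nrm B :=
  rfl

/-- Stage `0` of the tower is `loc O A`. [folklore] -/
theorem tower_zero (O : ValuationSubring K) (A : Subalgebra k K) : tower O A 0 = loc O A :=
  rfl

/-- The successor stage: `T_(m+1) = loc O (nrm (chart O T_m))`. [folklore] -/
theorem tower_succ (O : ValuationSubring K) (A : Subalgebra k K) (m : ℕ) :
    tower O A (m + 1) = loc O (nrm (chart O (tower O A m))) :=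
  rfl

/-- Unfolding of `ca`-membership. [folklore] -/
theorem mem_ca_iff (B : Subalgebra k K) {x : K} :
    x ∈ ca B ↔ ∃ hx : x ∈ B, ∃ n : ℕ, ∀ i : ℕ, n ≤ i → ∀ (M N : ModuleCat.{0} ↥B),
      Module.Finite ↥B M → Module.Finite ↥B N →
        ∀ e : CategoryTheory.Abelian.Ext.{0} M N i, (⟨x, hx⟩ : ↥B) • e = 0 :=
  Iff.rfl

/-- `ca B ⊆ B`. [folklore] -/
theorem ca_subset (B : Subalgebra k K) : ca B ⊆ (B : Set K) :=
  fun _ ⟨hx, _⟩ => hx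

/-! ## The crux over the named tower (re-abstraction of one term) -/

/-- **`NoZeno` restated over the named tower**: by ζ/δ-reduction alone the crux is
`Persistence → StrictDrop → ∀ p prime, ∀ datum, ∃ m, IsRegularLocalRing ↥(tower O A m)`.
Both directions re-abstract the same term; nothing is claimed. [folklore] -/
theorem noZeno_iff : NoZeno ↔ (Persistence → StrictDrop → ∀ p : ℕ, p.Prime →
    ∀ (k K : Type) [Field k] [CharP k p] [Field K] [Algebra k K] (O : ValuationSubring K)
      (A : Subalgebra k K), (∀ c : k, algebraMap k K c ∈ O) → A.FG → IsFractionRing ↥A K →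
      A.toSubring ≤ O.toSubring → ∃ m : ℕ, IsRegularLocalRing ↥(tower O A m)) :=
  ⟨fun h hP hD p hp k K _ _ _ _ O A hk hfg hfr hAO => h hP hD p hp k K O A hk hfg hfr hAO,
    fun h hP hD p hp k K _ _ _ _ O A hk hfg hfr hAO => h hP hD p hp k K O A hk hfg hfr hAO⟩

end Summit.ResolutionOfSingularities.ResolutionOfSingularities.Theorems.NoZeno.Birth

end
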